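import Literature.AlgebraicGeometry.Frobenioids.Thm49Assembly
import Literature.AlgebraicGeometry.Frobenioids.Thm49Compat
import Literature.AlgebraicGeometry.Frobenioids.Thm42OfPerfectionIsFrobenioid
import Literature.AlgebraicGeometry.Frobenioids.DivisorMonoidIsoDescentFormulas
import HarnessLib

/-!
# [FrdI] Theorem 4.9, the compatibility clause with `Ψ^Prime` AT THE `C`-LEVEL — the typed
# `PreFrobenioidData.Thm49_compat (ofFunctor Φ₁ F₁) (ofFunctor Φ₂ F₂) Ψ E e` (PROVED)

Mochizuki, *The geometry of Frobenioids I: the general theory*, Kyushu J. Math. **62** (2008) 293–400,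
§4, Theorem 4.9, statement kurims p. 88 l. 33 – p. 89 l. 2 ("an isomorphism of functors `Ψ^Φ : Φ₁ ⥲ Φ₂` …
lying over `Ψ`, which is compatible [when the `C_i` are of isotropic, but not of group-like type] with the
isomorphism `Ψ^Prime` of Theorem 4.2, (ii)"), proof p. 89 ll. 3–41 [cite: MochizukiFrdI2008, Thm. 4.9 p.88]
(render `paper:url-bbf705efa10f`); Theorem 4.2 (ii) p. 77 l. 23 – p. 78 l. 12 (the unique `Ψ^Prime`).

PROOF-ONLY file (cell abc-iut, layer L1, node `FrdI:Thm4.9`, L1-lead ruling R109 (3)(b) row «T49-compat-C»;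
seat abc-iut-w4-d105). The S5 sub-DAG closed Thm. 4.9 WITH its compatibility clause at the PERFECT isotropic
level (`FrdI.T49.exists_thm49_compat_perfect_primarySupp`, `Thm49CompatAssembly.lean`, seats abc-iut-w4-d099 /
w4-d105 / w4-d035 / w5-d021 / w4-d109) and the typed `Thm49` itself at the `C`-level
(`FrdI.T49.thm49_ofFunctor_of_isOfFSMType`, `Thm49Assembly.lean`, seat abc-iut-w4-d109). This file closes the
typed compatibility clause `PreFrobenioidData.Thm49_compat` (seat abc-iut-L1-t3) for the Frobenioids
`C_i → F_{Φ_i}` THEMSELVES (not assumed of perfect type), following print: "we may assume without loss of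
generality that `C₁`, `C₂` are … of perfect type" (p. 89 ll. 38–41, Thm. 3.4 (iii)) — here, the `C_i` being of
isotropic type (the clause's own hypothesis), the setting of the proof is built at THE perfections
`C_i^pf` of the `C_i` directly (`FrdI.T42.setting_perfection`, seat abc-iut-w4-d090; Prop. 3.2 (iii)
`PreFrobenioid.Perfection.isFrobenioid`, seats abc-iut-L1-d1 / L1-d9; Thm. 3.4 (iii)
`FrdI.T42.isFrobeniusCompatible_of_isOfFSMType`; Prop. 5.5 (iii) `Perfection.isRational_perfection_of`,
seat abc-iut-w4-d108), Thm. 4.9 with compatibility is invoked there, `Ψ^Φ` is descended along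
`Φ_i ↪ Φ_i^pf` TOGETHER WITH ITS DIVISOR CLAUSE "`Ψ^Φ_A(Div φ) = Div(Ψ φ)` for pre-steps `φ`"
(`FrdI.T49.exists_divisorMonoidIsoOver_of_perfection`, `DivisorMonoidIsoDescentFormulas.lean`, seat
abc-iut-L1-t14, over seat abc-iut-w4-d109's `Thm49PerfectionDescent`), THE `Ψ^Prime` of Thm. 4.2 (ii) at the
`C`-level is the cell's general closer `FrdI.T42.thm42ii_ofFunctor_of_isOfFSMType` (seats abc-iut-w5-d162 /
L1-d9, `Thm42OfPerfectionIsFrobenioid.lean`), and the compatibility "from the construction" (p. 89 ll. 12–33)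
is seat abc-iut-w4-d105's `FrdI.T49.thm49_compat_of_divClause` (`Thm49Compat.lean`): a divisor-computing
`Ψ^Φ` is compatible with ANY prime-correspondence satisfying clause (a) of Thm. 4.2 (ii), every element of
`Φ₁(A)` being a zero divisor `Div φ` (Def. 1.3 (iii)(d)).

* `FrdI.T49.exists_divisorMonoidIsoOver_divClause_of_isOfFSMType` — Thm. 4.9's `Ψ^Φ : Φ₁ ⥲ Φ₂` over `Ψ`
  ON THE `C_i` with its divisor clause on pre-steps;
* `FrdI.T49.exists_thm49_compat_ofFunctor_of_isOfFSMType` — **Thm. 4.9 WITH its compatibility clause at the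
  `C`-level**: THE `Ψ^Prime` of Thm. 4.2 (ii) (clauses (a), (b) — hence the unique family of the typed
  `Thm42ii`) and a `Ψ^Φ` over `Ψ` with the divisor clause satisfying the typed `Thm49_compat`;
* `FrdI.T49.exists_thm49_compat_ofFunctor_of_isOfFSMType'` — the same with `Ψ^Prime`'s clauses in the letter
  of the typed `PreFrobenioidData.Thm42ii` (operations `ofFunctor Φ_i F_i`);
* `FrdI.T49.exists_divisorMonoidIsoOver_thm49_compat_forall` — the same `Ψ^Φ` is compatible with EVERY
  prime-correspondence satisfying clause (a) of Thm. 4.2 (ii).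

Hypotheses ⊆ print's: Thm. 4.9's "rationally standard type" enters through "standard type" (`Thm42Setting`)
and "`C₁` of rational type" READ AT THE CONSTRUCTIONS (`hrat₁`, as in `thm49_ofFunctor_of_isOfFSMType`);
the clause's "isotropic, not group-like" is `Thm42Setting`; "`Φ_i` perf-factorial" is Thm. 4.2's standing
hypothesis; "bases of FSM-type" is the cell's route for Thm. 3.4 (ii)/(iii) (finding PR-1). No new
definitions; no statement of the paper is strengthened; nothing here bears on [IUTchIII] Cor. 3.12.
-/

namespace Literature.AlgebraicGeometry.Frobenioids

namespace FrdI.T49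

open CategoryTheory Opposite PreFrobenioidData

universe w v v' u u'

variable {D₁ : Type u} [Category.{v} D₁] {Φ₁ : D₁ᵒᵖ ⥤ CommMonCat.{w}} {C₁ : Type u'} [Category.{v'} C₁]
  {D₂ : Type u} [Category.{v} D₂] {Φ₂ : D₂ᵒᵖ ⥤ CommMonCat.{w}} {C₂ : Type u'} [Category.{v'} C₂]
  {F₁ : C₁ ⥤ ElemFrobenioid Φ₁} {F₂ : C₂ ⥤ ElemFrobenioid Φ₂}

/-- **Thm. 4.9's `Ψ^Φ` ON THE `C_i`, WITH ITS DIVISOR CLAUSE** (proof p. 89 ll. 25–41: "this isomorphism maps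
the subset `Φ₁(A₁) ⊆ Φ₁(A₁)^pf` onto the subset `Φ₂(A₂)`" … "by passing to perfections … we may assume …
perfect type"): for Frobenioids `C_i → F_{Φ_i}` of standard and isotropic, non-group-like type
(`Thm42Setting`) with perf-factorial `Φ_i` over bases of FSM-type, `C₁` of rational type at THE
birationalization / support, and an equivalence `Ψ : C₁ ⥲ C₂`, there is an isomorphism of functors
`Ψ^Φ : Φ₁ ⥲ Φ₂` lying over `Ψ` computing `Ψ^Φ_A(Div φ) = Div(Ψ φ)` for every pre-step `φ : A → B` of `C₁`.
Route: the setting of the proof at THE perfections `C_i^pf` (built directly on the `C_i`, which are of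
isotropic type), Thm. 4.9 with compatibility there (`exists_thm49_compat_perfect_primarySupp`), and the
descent of `Ψ^Φ` with its divisor clause (`exists_divisorMonoidIsoOver_of_perfection`, seat abc-iut-L1-t14).
[cite: MochizukiFrdI2008, Thm. 4.9 p.89] -/
theorem exists_divisorMonoidIsoOver_divClause_of_isOfFSMType (hF₁ : PreFrobenioid.IsFrobenioid F₁)
    (hF₂ : PreFrobenioid.IsFrobenioid F₂) (hD₁ : IsOfFSMType D₁) (hD₂ : IsOfFSMType D₂)
    (hpf₁ : Objectwise (fun M _ => IsPerfFactorial M) Φ₁) (hpf₂ : Objectwise (fun M _ => IsPerfFactorial M) Φ₂)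
    (hrat₁ : ∀ A : C₁, PreFrobenioidData.IsRational
      (PreFrobenioid.biratData hF₁ (PreFrobenioid.hasBiratSquares_of_isFrobenioid hF₁))
      (S := ofFunctor Φ₁ F₁) (fun a 𝔭 => PrimarySupp a 𝔭) A)
    (Ψ : C₁ ≌ C₂) (hT : Thm42Setting (ofFunctor Φ₁ F₁) (ofFunctor Φ₂ F₂)) :
    ∃ E : DivisorMonoidIsoOver (ofFunctor Φ₁ F₁) (ofFunctor Φ₂ F₂) Ψ,
      ∀ ⦃A B : C₁⦄ (φ : A ⟶ B), PreFrobenioid.IsPreStep F₁ φ →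
        E.iso A (PreFrobenioid.Div F₁ φ) = PreFrobenioid.Div F₂ (Ψ.functor.map φ) := by
  obtain ⟨hi₁, hi₂, hnd₁, hnd₂, ⟨N₁, hN₁⟩, ⟨N₂, hN₂⟩⟩ := FrdI.T42.of_thm42Setting hT
  have hs₁ := hT.standard.1
  have hs₂ := hT.standard.2
  -- Thm. 3.4 (iii): `Ψ` is compatible with arrows of Frobenius type; Thm. 3.4 (ii): `Ψ⁻¹` preserves pre-steps
  have hΨ : PreFrobenioid.IsFrobeniusCompatible F₁ F₂ Ψ.functor :=
    FrdI.T42.isFrobeniusCompatible_of_isOfFSMType Ψ hF₁ hF₂ hs₁.quasiIsotropic hs₂.quasiIsotropic hnd₁ hnd₂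
      hD₁ hD₂ hN₁ hN₂
  have hinv : ∀ ⦃X Y : C₂⦄ (g : X ⟶ Y), PreFrobenioid.IsPreStep F₂ g →
      PreFrobenioid.IsPreStep F₁ (Ψ.inverse.map g) := fun X Y g hg =>
    FrdI.isPreStep_map_of_quasiIsotropic_of_isOfFSMType hF₂ hF₁ hs₂.quasiIsotropic hs₁.quasiIsotropic hD₁
      Ψ.symm hg
  -- the perfections `C_i^pf` are Frobenioids (Prop. 3.2 (iii)); the setting of the proof there (Thm. 3.4 (iii))
  have hPf₁ := PreFrobenioid.Perfection.isFrobenioid hF₁ (FrdI.T42.isFrobeniusIsotropic_of_isOfIsotropicType hF₁ hi₁)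
  have hPf₂ := PreFrobenioid.Perfection.isFrobenioid hF₂ (FrdI.T42.isFrobeniusIsotropic_of_isOfIsotropicType hF₂ hi₂)
  haveI := PreFrobenioid.Perfection.map_isEquivalence (hF₁ := hF₁) (hF₂ := hF₂) Ψ hΨ
  have S := FrdI.T42.setting_perfection Ψ hF₁ hF₂ hPf₁ hPf₂ hi₁ hi₂ hpf₁ hpf₂ hs₁.nonDilating
    hs₂.nonDilating hD₁ hD₂ hN₁ hN₂ hΨ
  -- `Φ₂^pf` is non-dilating on `D₂` (standard type (e) + Prop. 3.2); `C₁^pf` is of rational type (Prop. 5.5 (iii))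
  have hndp₂ : IsNonDilatingOn (PreFrobenioid.Perfection.ops hF₂).monFunctor :=
    FrdI.isNonDilatingOn_of_ofFunctor (F := (PreFrobenioid.Perfection.ops hF₂).toFunctor)
      (PreFrobenioid.Perfection.isNonDilatingOn_ops hF₂ hs₂.nonDilating)
  have hratP : ∀ ⦃X : PreFrobenioid.Perfection hF₁⦄,
      PreFrobenioid.IsUniversallyDivFrobeniusTrivial (PreFrobenioid.Perfection.ops hF₁).toFunctor X →
        PreFrobenioidData.IsRational (PreFrobenioid.biratData S.isFrobenioid₁
          (PreFrobenioid.hasBiratSquares_of_isFrobenioid S.isFrobenioid₁))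
          (S := ofFunctor _ (PreFrobenioid.Perfection.ops hF₁).toFunctor) (fun a 𝔭 => PrimarySupp a 𝔭) X :=
    fun X _ => PreFrobenioid.Perfection.isRational_perfection_of hF₁ hPf₁ hrat₁ X
  -- Thm. 4.9 WITH compatibility at the perfections: `Ψ^Φ'` over `Ψ^pf` with its divisor clause
  obtain ⟨E', -, -, hE', -⟩ := exists_thm49_compat_perfect_primarySupp S hndp₂ hratP
  -- descent along `Φ_i ↪ Φ_i^pf`, keeping the divisor clause
  obtain ⟨E, -, hE⟩ := exists_divisorMonoidIsoOver_of_perfection hF₁ hF₂ Ψ hΨ hinv E'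
    (fun X Y f hf => hE' f hf)
  exact ⟨E, hE⟩

/-- **[FrdI] Theorem 4.9 WITH its compatibility clause, AT THE `C`-LEVEL** — the typed
`PreFrobenioidData.Thm49_compat (ofFunctor Φ₁ F₁) (ofFunctor Φ₂ F₂) Ψ E e` (statement p. 88 l. 33 – p. 89
l. 2): for Frobenioids `C_i → F_{Φ_i}` of standard and isotropic, non-group-like type (`Thm42Setting`: the
clause's "when the `C_i` are of isotropic, but not of group-like type" together with Thm. 4.2's / Thm. 4.9's
"standard type") with perf-factorial `Φ_i` over bases of FSM-type, `C₁` of rational type at THE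
birationalization / support ("rationally standard"), and an equivalence `Ψ : C₁ ⥲ C₂`, there exist THE
`Ψ^Prime` of Thm. 4.2 (ii) — bijections `e A : Prime(Φ₁(A)) ≃ Prime(Φ₂(Ψ A))` with clauses (a) and (b),
hence (typed `Thm42ii`, `FrdI.T42.thm42ii_ofFunctor_of_isOfFSMType`) the unique such family — and an
isomorphism of functors `Ψ^Φ : Φ₁ ⥲ Φ₂` lying over `Ψ` computing `Div(Ψ φ) = Ψ^Φ_A(Div φ)` on pre-steps, such
that `Ψ^Φ_A` maps `Φ₁(A)_𝔭` onto `Φ₂(Ψ A)_{Ψ^Prime(𝔭)}` (the typed `Thm49_compat`; "from the construction",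
p. 89 ll. 12–33, via `FrdI.T49.thm49_compat_of_divClause`). [cite: MochizukiFrdI2008, Thm. 4.9 p.88] -/
theorem exists_thm49_compat_ofFunctor_of_isOfFSMType (hF₁ : PreFrobenioid.IsFrobenioid F₁)
    (hF₂ : PreFrobenioid.IsFrobenioid F₂) (hD₁ : IsOfFSMType D₁) (hD₂ : IsOfFSMType D₂)
    (hpf₁ : Objectwise (fun M _ => IsPerfFactorial M) Φ₁) (hpf₂ : Objectwise (fun M _ => IsPerfFactorial M) Φ₂)
    (hrat₁ : ∀ A : C₁, PreFrobenioidData.IsRational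
      (PreFrobenioid.biratData hF₁ (PreFrobenioid.hasBiratSquares_of_isFrobenioid hF₁))
      (S := ofFunctor Φ₁ F₁) (fun a 𝔭 => PrimarySupp a 𝔭) A)
    (Ψ : C₁ ≌ C₂) (hT : Thm42Setting (ofFunctor Φ₁ F₁) (ofFunctor Φ₂ F₂)) :
    ∃ (E : DivisorMonoidIsoOver (ofFunctor Φ₁ F₁) (ofFunctor Φ₂ F₂) Ψ)
      (e : ∀ A : C₁, Primes (Φ₁.obj (op (PreFrobenioid.baseObj F₁ A))) ≃
        Primes (Φ₂.obj (op (PreFrobenioid.baseObj F₂ (Ψ.functor.obj A))))),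
      (∀ (A : C₁) (𝔭 : Primes (Φ₁.obj (op (PreFrobenioid.baseObj F₁ A)))),
        (∀ ⦃B : C₁⦄ (φ : A ⟶ B), PreFrobenioid.IsCoAngularPreStep F₁ φ →
            (PreFrobenioid.Div F₁ φ ∈ 𝔭.submonoid ↔
              PreFrobenioid.Div F₂ (Ψ.functor.map φ) ∈ (e A 𝔭).submonoid)) ∧
        ∀ ⦃B : C₁⦄ (ψ : B ⟶ A), PreFrobenioid.IsCoAngularPreStep F₁ ψ →
          ((∃ y ∈ 𝔭.submonoid, pull Φ₁ (PreFrobenioid.Base F₁ ψ) y = PreFrobenioid.Div F₁ ψ) ↔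
            ∃ y ∈ (e A 𝔭).submonoid, pull Φ₂ (PreFrobenioid.Base F₂ (Ψ.functor.map ψ)) y =
              PreFrobenioid.Div F₂ (Ψ.functor.map ψ))) ∧
      (∀ ⦃A B : C₁⦄ (φ : A ⟶ B), PreFrobenioid.IsPreStep F₁ φ →
          E.iso A (PreFrobenioid.Div F₁ φ) = PreFrobenioid.Div F₂ (Ψ.functor.map φ)) ∧
      Literature.AlgebraicGeometry.Frobenioids.PreFrobenioidData.Thm49_compat
        (ofFunctor Φ₁ F₁) (ofFunctor Φ₂ F₂) Ψ E e := by
  -- THE `Ψ^Prime` of Thm. 4.2 (ii) at the `C`-level (general closer: descent of primes through `C_i^pf`)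
  obtain ⟨e, he, -⟩ := FrdI.T42.thm42ii_ofFunctor_of_isOfFSMType Ψ hF₁ hF₂ hpf₁ hpf₂ hD₁ hD₂ hT
  have he' : ∀ (A : C₁) (𝔭 : Primes (Φ₁.obj (op (PreFrobenioid.baseObj F₁ A)))),
      (∀ ⦃B : C₁⦄ (φ : A ⟶ B), PreFrobenioid.IsCoAngularPreStep F₁ φ →
          (PreFrobenioid.Div F₁ φ ∈ 𝔭.submonoid ↔
            PreFrobenioid.Div F₂ (Ψ.functor.map φ) ∈ (e A 𝔭).submonoid)) ∧
        ∀ ⦃B : C₁⦄ (ψ : B ⟶ A), PreFrobenioid.IsCoAngularPreStep F₁ ψ →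
          ((∃ y ∈ 𝔭.submonoid, pull Φ₁ (PreFrobenioid.Base F₁ ψ) y = PreFrobenioid.Div F₁ ψ) ↔
            ∃ y ∈ (e A 𝔭).submonoid, pull Φ₂ (PreFrobenioid.Base F₂ (Ψ.functor.map ψ)) y =
              PreFrobenioid.Div F₂ (Ψ.functor.map ψ)) := fun A 𝔭 =>
    ⟨fun B φ hφ => (he A 𝔭).1 φ ((ofFunctor_isCoAngularPreStep F₁ φ).mpr hφ),
      fun B ψ hψ => (he A 𝔭).2 ψ ((ofFunctor_isCoAngularPreStep F₁ ψ).mpr hψ)⟩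
  -- Thm. 4.9's `Ψ^Φ` on the `C_i` with its divisor clause
  obtain ⟨E, hE⟩ := exists_divisorMonoidIsoOver_divClause_of_isOfFSMType hF₁ hF₂ hD₁ hD₂ hpf₁ hpf₂ hrat₁ Ψ hT
  -- compatibility "from the construction": divisor clause + clause (a)
  exact ⟨E, e, he', hE, thm49_compat_of_divClause F₁ F₂ Ψ hF₁ E e (fun A 𝔭 => (he' A 𝔭).1)
    fun _ _ φ hφ => hE φ hφ.2⟩

/-- **The compatibility holds with respect to EVERY prime-correspondence satisfying clause (a) of Thm. 4.2
(ii)** (p. 89 ll. 1–2 with ll. 12–33 "it follows immediately from the construction"): under the hypotheses of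
`exists_thm49_compat_ofFunctor_of_isOfFSMType`, Thm. 4.9's `Ψ^Φ` on the `C_i` (with its divisor clause on
pre-steps) satisfies the typed `Thm49_compat` for every family `e A : Prime(Φ₁(A)) ≃ Prime(Φ₂(Ψ A))` with
"`Div φ ∈ Φ₁(A)_𝔭 ⟺ Div(Ψ φ) ∈ Φ₂(Ψ A)_{e(𝔭)}` for the co-angular pre-steps `φ` out of `A`" — in particular
for THE `Ψ^Prime` (unique by the typed `Thm42ii`). [cite: MochizukiFrdI2008, Thm. 4.9 p.89] -/
theorem exists_divisorMonoidIsoOver_thm49_compat_forall (hF₁ : PreFrobenioid.IsFrobenioid F₁)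
    (hF₂ : PreFrobenioid.IsFrobenioid F₂) (hD₁ : IsOfFSMType D₁) (hD₂ : IsOfFSMType D₂)
    (hpf₁ : Objectwise (fun M _ => IsPerfFactorial M) Φ₁) (hpf₂ : Objectwise (fun M _ => IsPerfFactorial M) Φ₂)
    (hrat₁ : ∀ A : C₁, PreFrobenioidData.IsRational
      (PreFrobenioid.biratData hF₁ (PreFrobenioid.hasBiratSquares_of_isFrobenioid hF₁))
      (S := ofFunctor Φ₁ F₁) (fun a 𝔭 => PrimarySupp a 𝔭) A)
    (Ψ : C₁ ≌ C₂) (hT : Thm42Setting (ofFunctor Φ₁ F₁) (ofFunctor Φ₂ F₂)) :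
    ∃ E : DivisorMonoidIsoOver (ofFunctor Φ₁ F₁) (ofFunctor Φ₂ F₂) Ψ,
      (∀ ⦃A B : C₁⦄ (φ : A ⟶ B), PreFrobenioid.IsPreStep F₁ φ →
          E.iso A (PreFrobenioid.Div F₁ φ) = PreFrobenioid.Div F₂ (Ψ.functor.map φ)) ∧
      ∀ (e : ∀ A : C₁, Primes (Φ₁.obj (op (PreFrobenioid.baseObj F₁ A))) ≃
          Primes (Φ₂.obj (op (PreFrobenioid.baseObj F₂ (Ψ.functor.obj A))))),
        (∀ (A : C₁) (𝔭 : Primes (Φ₁.obj (op (PreFrobenioid.baseObj F₁ A)))) ⦃B : C₁⦄ (φ : A ⟶ B),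
          PreFrobenioid.IsCoAngularPreStep F₁ φ →
            (PreFrobenioid.Div F₁ φ ∈ 𝔭.submonoid ↔
              PreFrobenioid.Div F₂ (Ψ.functor.map φ) ∈ (e A 𝔭).submonoid)) →
        Literature.AlgebraicGeometry.Frobenioids.PreFrobenioidData.Thm49_compat
          (ofFunctor Φ₁ F₁) (ofFunctor Φ₂ F₂) Ψ E e := by
  obtain ⟨E, hE⟩ := exists_divisorMonoidIsoOver_divClause_of_isOfFSMType hF₁ hF₂ hD₁ hD₂ hpf₁ hpf₂ hrat₁ Ψ hT
  exact ⟨E, hE, fun e he => thm49_compat_of_divClause F₁ F₂ Ψ hF₁ E e he fun _ _ φ hφ => hE φ hφ.2⟩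

/-- **The same, with `Ψ^Prime`'s clauses in the letter of the typed `PreFrobenioidData.Thm42ii`** (operations
`ofFunctor Φ_i F_i`): the family `e` below is a witness of the unique-existence statement `Thm42ii` (hence THE
`Ψ^Prime`), and Thm. 4.9's `Ψ^Φ` satisfies the typed `Thm49_compat` with respect to it.
[cite: MochizukiFrdI2008, Thm. 4.9 p.88] -/
theorem exists_thm49_compat_ofFunctor_of_isOfFSMType' (hF₁ : PreFrobenioid.IsFrobenioid F₁)
    (hF₂ : PreFrobenioid.IsFrobenioid F₂) (hD₁ : IsOfFSMType D₁) (hD₂ : IsOfFSMType D₂)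
    (hpf₁ : Objectwise (fun M _ => IsPerfFactorial M) Φ₁) (hpf₂ : Objectwise (fun M _ => IsPerfFactorial M) Φ₂)
    (hrat₁ : ∀ A : C₁, PreFrobenioidData.IsRational
      (PreFrobenioid.biratData hF₁ (PreFrobenioid.hasBiratSquares_of_isFrobenioid hF₁))
      (S := ofFunctor Φ₁ F₁) (fun a 𝔭 => PrimarySupp a 𝔭) A)
    (Ψ : C₁ ≌ C₂) (hT : Thm42Setting (ofFunctor Φ₁ F₁) (ofFunctor Φ₂ F₂)) :
    ∃ (E : DivisorMonoidIsoOver (ofFunctor Φ₁ F₁) (ofFunctor Φ₂ F₂) Ψ)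
      (e : ∀ A : C₁, Primes ((ofFunctor Φ₁ F₁).Mon ((ofFunctor Φ₁ F₁).base.obj A)) ≃
        Primes ((ofFunctor Φ₂ F₂).Mon ((ofFunctor Φ₂ F₂).base.obj (Ψ.functor.obj A)))),
      (∀ (A : C₁) (𝔭 : Primes ((ofFunctor Φ₁ F₁).Mon ((ofFunctor Φ₁ F₁).base.obj A))),
        (∀ ⦃B : C₁⦄ (φ : A ⟶ B), (ofFunctor Φ₁ F₁).IsCoAngularPreStep φ →
            ((ofFunctor Φ₁ F₁).div φ ∈ 𝔭.submonoid ↔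
              (ofFunctor Φ₂ F₂).div (Ψ.functor.map φ) ∈ (e A 𝔭).submonoid)) ∧
        ∀ ⦃B : C₁⦄ (ψ : B ⟶ A), (ofFunctor Φ₁ F₁).IsCoAngularPreStep ψ →
          ((∃ y ∈ 𝔭.submonoid, (ofFunctor Φ₁ F₁).pull ((ofFunctor Φ₁ F₁).base.map ψ) y = (ofFunctor Φ₁ F₁).div ψ) ↔
            ∃ y ∈ (e A 𝔭).submonoid, (ofFunctor Φ₂ F₂).pull ((ofFunctor Φ₂ F₂).base.map (Ψ.functor.map ψ)) y =
              (ofFunctor Φ₂ F₂).div (Ψ.functor.map ψ))) ∧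
      (∀ ⦃A B : C₁⦄ (φ : A ⟶ B), PreFrobenioid.IsPreStep F₁ φ →
          E.iso A (PreFrobenioid.Div F₁ φ) = PreFrobenioid.Div F₂ (Ψ.functor.map φ)) ∧
      Literature.AlgebraicGeometry.Frobenioids.PreFrobenioidData.Thm49_compat
        (ofFunctor Φ₁ F₁) (ofFunctor Φ₂ F₂) Ψ E e := by
  obtain ⟨e, he, -⟩ := FrdI.T42.thm42ii_ofFunctor_of_isOfFSMType Ψ hF₁ hF₂ hpf₁ hpf₂ hD₁ hD₂ hT
  obtain ⟨E, hE⟩ := exists_divisorMonoidIsoOver_divClause_of_isOfFSMType hF₁ hF₂ hD₁ hD₂ hpf₁ hpf₂ hrat₁ Ψ hT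
  exact ⟨E, e, he, hE, thm49_compat_of_divClause F₁ F₂ Ψ hF₁ E e
    (fun A 𝔭 B φ hφ => (he A 𝔭).1 φ ((ofFunctor_isCoAngularPreStep F₁ φ).mpr hφ)) fun _ _ φ hφ => hE φ hφ.2⟩

end FrdI.T49

end Literature.AlgebraicGeometry.Frobenioids
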